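import Mathlib.Analysis.Normed.Module.Connected
import Mathlib.Topology.Instances.Shrink
import Mathlib.Data.Countable.Small
import Literature.Topology.FourManifolds.HomotopyS4Compact
import Literature.AlgebraicTopology.SingularHomology.ExcisionMayerVietoris
import Literature.AlgebraicTopology.SingularHomology.NoncompactManifold
import Literature.AlgebraicTopology.SingularHomology.NoncompactManifoldProofs
import HarnessLib

/-!
# `Literature.Topology.FourManifolds.compactSpace_of_homotopyEquiv_sphere_four`: proof via Hatcher Prop. 3.29 and Cor. 2.14

Proof file (sibling of `Literature.Topology.FourManifolds.HomotopyS4Compact`) for the named fact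
`Literature.Topology.FourManifolds.compactSpace_of_homotopyEquiv_sphere_four` (every Hausdorff second-countable `C^∞` 4-manifold
homotopy equivalent to `S⁴` is compact). The printed argument (A. Hatcher, *Algebraic Topology*,
CUP 2002) is: `H₄(M; ℤ) ≅ H₄(S⁴; ℤ) ≅ ℤ` by homotopy invariance (Cor. 2.11) and the homology of
spheres (Cor. 2.14), whereas a connected non-compact `n`-manifold has `Hₙ(M; ℤ) = 0` (Prop. 3.29);
`M` is connected because `S⁴` is (path components are homotopy invariant).

This file carries out that argument sorry-free over the `Literature` singular-homology layer.
It first isolates the two textbook inputs as hypotheses (they are NAMED FACTS of the layer):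

* Hatcher Prop. 3.29 (`Hₖ(X; ℤ) = 0` for `k ≥ n` on a connected non-compact `n`-manifold), used
  at `n = 4` and universe `0`; the hypothesis `h329` below is spelled out and is *verbatim*
  `∀ (X : Type) [TopologicalSpace X], Literature.isZero_singularHomology_of_noncompactSpace ℤ X 4`
  (named fact of `Literature.AlgebraicTopology.SingularHomology.NoncompactManifold`);
  `compactSpace_of_homotopyEquiv_sphere_four_of_facts` is the same reduction with `h329` typed by
  that named fact;
* `Literature.nonempty_singularHomology_sphere_iso ℤ ℤ` (Hatcher Cor. 2.14,
  `Literature.AlgebraicTopology.SingularHomology.ExcisionMayerVietoris`).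

Homotopy invariance (Cor. 2.11) is Mathlib's
`TopCat.Homotopy.congr_homologyMap_singularChainComplexFunctor`, packaged as
`Literature.AlgebraicTopology.SingularHomology.singularHomology.isoOfHomotopyEquiv`.

## Universes

`Literature.compactSpace_of_homotopyEquiv_sphere_four.{u}` quantifies over `M : Type u` while `S⁴ : Type`
and `Literature.AlgebraicTopology.SingularHomology.singularHomology.isoOfHomotopyEquiv` needs both spaces in one universe. We avoid any
universe-comparison of homology by shrinking `M`: a second-countable `T₁` space is `Small.{0}`
(`Literature.Topology.FourManifolds.small_of_secondCountableTopology`: it injects into the power set of a countable basis), so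
`Shrink.{0} M : Type` is a homeomorphic copy (`Shrink.homeomorph`, Mathlib) to which the manifold
structure is transported (`ChartedSpace.comp` of the singleton chart of the homeomorphism); the
whole homological argument then runs in `Type`, and compactness is transported back.

## Main statements

* `Literature.Topology.FourManifolds.pathConnectedSpace_of_homotopyEquiv`: a space homotopy equivalent to a path-connected space
  is path connected (any universes).
* `Literature.Topology.FourManifolds.small_of_secondCountableTopology`: a second-countable `T₁` space is `Small.{w}`.
* `Literature.Topology.FourManifolds.pathConnectedSpace_sphere_four`: `S⁴` is path connected (Mathlib `isPathConnected_sphere`).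
* `Literature.compactSpace_of_homotopyEquiv_sphere_four_of' h329 h214` — the reduction proper, with
  the sphere input in the form that is used, `h214 : H₄(S⁴; ℤ) ≠ 0` (PROVED).
* `Literature.compactSpace_of_homotopyEquiv_sphere_four_of h329 h214 :
  compactSpace_of_homotopyEquiv_sphere_four` — the reduction with `h214` Cor. 2.14 as printed
  (`Hₙ(Sⁿ; ℤ) ≅ ℤ`) (PROVED).
* `Literature.Topology.FourManifolds.compactSpace_of_homotopyEquiv_sphere_four_of_facts` — the same, with both hypotheses the
  named facts `isZero_singularHomology_of_noncompactSpace ℤ · 4` and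
  `nonempty_singularHomology_sphere_iso ℤ ℤ` (PROVED).
* **`Literature.compactSpace_of_homotopyEquiv_sphere_four_holds : compactSpace_of_homotopyEquiv_sphere_four`**
  (no hypotheses, PROVED): `_of'` fed with the two inputs as proved in the concrete
  singular-chain development of `Literature.AlgebraicTopology.SingularHomology`:
  Prop. 3.29 for `X : Type`, `n = 4`
  (`Literature.AlgebraicTopology.SingularHomology.isZero_singularHomology_of_noncompactSpace_holds`,
  `…SingularHomology.NoncompactManifoldProofs`: Lemma 3.27 via local homology, relative
  Mayer–Vietoris, excision by barycentric subdivision) and `H₄(S⁴; ℤ) ≠ 0`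
  (`Literature.AlgebraicTopology.SingularHomology.not_isZero_singularHomology_unitSphere`, `…SingularHomology.LocalHomology`:
  Mayer–Vietoris for `ℝⁿ ∖ 0` and the radial homotopy equivalence `S⁴ ≃ₕ ℝ⁵ ∖ 0`).

## References

* A. Hatcher, *Algebraic Topology*, CUP 2002: Prop. 3.29 (p. 239), Cor. 2.14, Cor. 2.11,
  and p. 231 (definition of `n`-manifold: Hausdorff, locally homeomorphic to `ℝⁿ`).
-/

noncomputable section

open CategoryTheory Limits ContinuousMap
open scoped Manifold ContDiff

universe u v w

namespace Literature.Topology.FourManifolds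

/-- A space homotopy equivalent to a path-connected space is path connected: if `g ∘ f ≃ 𝟙` then
`x ∼ g (f x)` along the homotopy, and `g` maps a path `f x ⇝ f y` to a path `g (f x) ⇝ g (f y)`
(Hatcher 2002, Ch. 0, Ex. 0.10 / §2.1: `H₀` and path components are homotopy invariants). [folklore] -/
theorem pathConnectedSpace_of_homotopyEquiv {X : Type u} {Y : Type v} [TopologicalSpace X]
    [TopologicalSpace Y] (e : X ≃ₕ Y) [PathConnectedSpace Y] : PathConnectedSpace X := by
  obtain ⟨H⟩ := e.left_inv
  have hj : ∀ x : X, Joined (e.invFun (e.toFun x)) x := fun x => ⟨H.evalAt x⟩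
  refine ⟨⟨e.invFun (Classical.arbitrary Y)⟩, fun x y => ?_⟩
  exact ((hj x).symm.trans
    ⟨(PathConnectedSpace.somePath (e.toFun x) (e.toFun y)).map e.invFun.continuous⟩).trans (hj y)

/-- A second-countable `T₁` space is `w`-small for every universe `w` (in particular `Small.{0}`):
`x ↦ {b ∈ B | x ∈ b}` is injective for a countable basis `B`, since `{y}ᶜ` is an open
neighbourhood of any `x ≠ y`. [folklore] -/
theorem small_of_secondCountableTopology (M : Type u) [TopologicalSpace M]
    [SecondCountableTopology M] [T1Space M] : Small.{w} M := by
  obtain ⟨B, hBc, -, hB⟩ := TopologicalSpace.exists_countable_basis M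
  haveI : Countable B := hBc.to_subtype
  refine small_of_injective (β := Set B) (f := fun x : M => {b : B | x ∈ (b : Set M)}) ?_
  intro x y hxy
  have hxy' : ∀ b : B, x ∈ (b : Set M) ↔ y ∈ (b : Set M) := fun b => Set.ext_iff.mp hxy b
  by_contra hne
  obtain ⟨b, hbB, hxb, hby⟩ :=
    hB.exists_subset_of_mem_open (Set.mem_compl_singleton_iff.mpr hne) isOpen_compl_singleton
  exact hby ((hxy' ⟨b, hbB⟩).mp hxb) rfl

/-- The standard sphere `S⁴ ⊂ ℝ⁵` is path connected (Mathlib `isPathConnected_sphere`, as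
`1 < 5 = rank ℝ⁵`). Stated as a theorem, not an instance. [folklore] -/
theorem pathConnectedSpace_sphere_four :
    PathConnectedSpace (Metric.sphere (0 : EuclideanSpace ℝ (Fin 5)) 1) := by
  refine isPathConnected_iff_pathConnectedSpace.mp (isPathConnected_sphere ?_ 0 zero_le_one)
  rw [← Module.finrank_eq_rank, finrank_euclideanSpace_fin]
  exact Nat.one_lt_cast.mpr (by norm_num)

/-- **Reduction of `compactSpace_of_homotopyEquiv_sphere_four` to Hatcher Prop. 3.29 and the
non-vanishing of `H₄(S⁴; ℤ)`.** GIVEN `h329 : Hₖ(X; ℤ) = 0` for `k ≥ 4` on every connected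
non-compact topological 4-manifold `X : Type` (Hatcher 2002, Prop. 3.29; definitionally
`∀ X, Literature.isZero_singularHomology_of_noncompactSpace ℤ X 4`) and `h214 : H₄(S⁴; ℤ) ≠ 0` (the half
of Hatcher 2002, Cor. 2.14 that is used), every Hausdorff second-countable `C^∞` 4-manifold
`M : Type u` homotopy equivalent to `S⁴` is compact.
Proof: if not, shrink `M` to `M₀ : Type` (second countable ⇒ small), transport the manifold
structure and non-compactness along `Shrink.homeomorph`; `M₀ ≃ₕ S⁴` makes `M₀` path connected, so
`h329` gives `H₄(M₀; ℤ) = 0`, while homotopy invariance (Cor. 2.11,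
`singularHomology.isoOfHomotopyEquiv`) gives `H₄(S⁴; ℤ) ≅ H₄(M₀; ℤ)`, contradicting `h214`.
[cite: HatcherAT2002, Prop. 3.29 and Cor. 2.14] -/
theorem compactSpace_of_homotopyEquiv_sphere_four_of'
    (h329 : ∀ (X : Type) [TopologicalSpace X] [T2Space X]
      [ChartedSpace (EuclideanSpace ℝ (Fin 4)) X] [ConnectedSpace X] [NoncompactSpace X] {i : ℕ},
      4 ≤ i → IsZero (Literature.AlgebraicTopology.SingularHomology.singularHomology ℤ ℤ X i))
    (h214 : ¬ IsZero (Literature.AlgebraicTopology.SingularHomology.singularHomology ℤ ℤ (Metric.sphere (0 : EuclideanSpace ℝ (Fin 5)) 1) 4)) :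
    compactSpace_of_homotopyEquiv_sphere_four.{u} := by
  intro M _ _ _ _ _ e
  by_contra hM
  haveI : NoncompactSpace M := not_compactSpace_iff.mp hM
  haveI : Small.{0} M := small_of_secondCountableTopology M
  let φ : M ≃ₜ Shrink.{0} M := Shrink.homeomorph M
  haveI : T2Space (Shrink.{0} M) := φ.t2Space
  letI : ChartedSpace M (Shrink.{0} M) :=
    φ.symm.toOpenPartialHomeomorph.singletonChartedSpace rfl
  letI : ChartedSpace (EuclideanSpace ℝ (Fin 4)) (Shrink.{0} M) :=
    ChartedSpace.comp (EuclideanSpace ℝ (Fin 4)) M (Shrink.{0} M)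
  haveI : NoncompactSpace (Shrink.{0} M) :=
    not_compactSpace_iff.mp fun _ => hM φ.symm.compactSpace
  let e₀ : Shrink.{0} M ≃ₕ Metric.sphere (0 : EuclideanSpace ℝ (Fin 5)) 1 :=
    φ.symm.toHomotopyEquiv.trans e
  haveI := pathConnectedSpace_sphere_four
  haveI : PathConnectedSpace (Shrink.{0} M) := pathConnectedSpace_of_homotopyEquiv e₀
  have hz : IsZero (Literature.AlgebraicTopology.SingularHomology.singularHomology ℤ ℤ (Shrink.{0} M) 4) := h329 (Shrink.{0} M) le_rfl
  exact h214 (hz.of_iso (Literature.AlgebraicTopology.SingularHomology.singularHomology.isoOfHomotopyEquiv ℤ ℤ e₀ 4).symm)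

/-- **Reduction of `compactSpace_of_homotopyEquiv_sphere_four` to Hatcher Prop. 3.29 and
Cor. 2.14.** GIVEN the named facts `h329 : Hₖ(X; ℤ) = 0` for `k ≥ 4` on every connected
non-compact topological 4-manifold `X : Type` (Hatcher 2002, Prop. 3.29; definitionally
`∀ X, Literature.isZero_singularHomology_of_noncompactSpace ℤ X 4`) and
`h214 : Hₙ(Sⁿ; ℤ) ≅ ℤ` for `n ≥ 1` (Hatcher 2002, Cor. 2.14), every Hausdorff second-countable
`C^∞` 4-manifold `M : Type u` homotopy equivalent to `S⁴` is compact: `H₄(S⁴; ℤ) ≅ ℤ ≠ 0`, and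
`compactSpace_of_homotopyEquiv_sphere_four_of'`. [cite: HatcherAT2002, Prop. 3.29 and Cor. 2.14] -/
theorem compactSpace_of_homotopyEquiv_sphere_four_of
    (h329 : ∀ (X : Type) [TopologicalSpace X] [T2Space X]
      [ChartedSpace (EuclideanSpace ℝ (Fin 4)) X] [ConnectedSpace X] [NoncompactSpace X] {i : ℕ},
      4 ≤ i → IsZero (Literature.AlgebraicTopology.SingularHomology.singularHomology ℤ ℤ X i))
    (h214 : Literature.AlgebraicTopology.SingularHomology.nonempty_singularHomology_sphere_iso ℤ ℤ) :
    compactSpace_of_homotopyEquiv_sphere_four.{u} := by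
  refine compactSpace_of_homotopyEquiv_sphere_four_of' h329 fun hZ => ?_
  obtain ⟨i⟩ := h214 (n := 4) (by norm_num)
  have hs : Subsingleton (ULift.{0} ℤ) :=
    ModuleCat.isZero_of_iff_subsingleton.mp (hZ.of_iso i.symm)
  exact absurd (hs.elim (ULift.up 0) (ULift.up 1)) (by simp)

/-- The reduction with both inputs typed by their `Literature` named facts: GIVEN Hatcher Prop. 3.29
for every topological 4-manifold `X : Type` (`isZero_singularHomology_of_noncompactSpace ℤ X 4`)
and Hatcher Cor. 2.14 (`nonempty_singularHomology_sphere_iso ℤ ℤ`), the named fact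
`compactSpace_of_homotopyEquiv_sphere_four` holds (at every universe). Definitionally
`compactSpace_of_homotopyEquiv_sphere_four_of`. [cite: HatcherAT2002, Prop. 3.29 and Cor. 2.14] -/
theorem compactSpace_of_homotopyEquiv_sphere_four_of_facts
    (h329 : ∀ (X : Type) [TopologicalSpace X], Literature.AlgebraicTopology.SingularHomology.isZero_singularHomology_of_noncompactSpace ℤ X 4)
    (h214 : Literature.AlgebraicTopology.SingularHomology.nonempty_singularHomology_sphere_iso ℤ ℤ) :
    compactSpace_of_homotopyEquiv_sphere_four.{u} :=
  compactSpace_of_homotopyEquiv_sphere_four_of (fun X _ _ _ _ _ _ hi => h329 X hi) h214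

/-- **The named fact `compactSpace_of_homotopyEquiv_sphere_four` holds** (at every universe):
every Hausdorff second-countable `C^∞` 4-manifold homotopy equivalent to `S⁴` is compact
(Hatcher 2002, Prop. 3.29 with Cor. 2.11 and Cor. 2.14). This is
`compactSpace_of_homotopyEquiv_sphere_four_of'` applied to the two inputs proved in the concrete
singular-chain development: Prop. 3.29 for 4-manifolds `X : Type`
(`isZero_singularHomology_of_noncompactSpace_holds`) and `H₄(S⁴; ℤ) ≠ 0`
(`not_isZero_singularHomology_unitSphere`). [cite: HatcherAT2002, Prop. 3.29, Cor. 2.11, Cor. 2.14] -/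
theorem compactSpace_of_homotopyEquiv_sphere_four_holds :
    compactSpace_of_homotopyEquiv_sphere_four.{u} :=
  compactSpace_of_homotopyEquiv_sphere_four_of'
    (fun X _ _ _ _ _ _ hi => Literature.AlgebraicTopology.SingularHomology.isZero_singularHomology_of_noncompactSpace_holds ℤ X 4 hi)
    (Literature.AlgebraicTopology.SingularHomology.not_isZero_singularHomology_unitSphere ℤ ℤ 4 (by norm_num))

end Literature.Topology.FourManifolds

end
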